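import Summits.ABC.ABC.Theorems.IsogenyGlueCongruenceEllipticGluingPrimeBoundStubBigImageTorsionCoreAux2
import Summits.ABC.ABC.Theorems.IsogenyGlueCongruenceEllipticGluingPrimeBoundStubBigImageTorsionCoreAux3
import Summits.ABC.ABC.Theorems.IsogenyGlueCongruenceEllipticGluingPrimeBoundStubBigImageTorsionCoreAux5
import HarnessLib

/-!
# Crux `EllipticGluingPrimeBound`, line Sketch — stub `stub_bigImageTorsionCore` ((N†))

Stub `stub_bigImageTorsionCore` of line `Sketch` (isotypic–Minkowski reduction) of crux U
`Summit.ABC.ABC.Theses.IsogenyGlueCongruence.EllipticGluingPrimeBound` (item stmt-ABC-13919),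
registered signature (namespace `Summit.ABC.ABC.Theorems.IsotypicMinkowski`).

**Statement.** There is `L₀` (`= 2`) such that for every elliptic curve `W/ℚ` with AV-model `E`
(a `Γ_ℚ`-equivariant `e : E(ℚ̄) ≃+ W(ℚ̄)`), every `A/ℚ` which is geometrically `E`-isotypic
(every non-zero quotient of `A_ℚ̄` receives a non-zero map from `E_ℚ̄`) with `Hom_ℚ(E, A) = 0`,
and every prime `ℓ > L₀` at which `ρ̄_{W,ℓ}` is surjective and `W[ℓ] ↪ A(ℚ̄)`
`Γ_ℚ`-equivariantly, there are `r ≤ 4 dim A` and a finite subgroup `G ≤ GL_r(ℤ)` with `ℓ ∣ |G|`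
(namely the Galois image on the lattice `Hom(E_ℚ̄, A_ℚ̄)`; Minkowski then gives `ℓ ≤ r + 1`).

**Proof** (no Faltings, no tensor splitting, no Brauer–Nesbitt). `H = Hom(E_ℚ̄, A_ℚ̄)` with its
Galois action `ρ` through a finite image `G` (`BigImage.homGaloisLattice'`, helpers 5/5). If
`ℓ ∣ |G|`, `G ↪ GL_r(ℤ)` (`BigImage.exists_subgroup_generalLinearGroup_mulEquiv`). If `ℓ ∤ |G|`
(`BigImage.exists_subgroup_dvd_card`): `V = E[ℓ]` is a plane over `𝔽_ℓ` on which every additive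
automorphism is Galois (surjectivity, transported along `e`), so the operators of `Γ' = ker ρ`
span `End(V)` (`span_smul_eq_top`, helpers 2/5); the corner evaluation `ev : H × E(ℚ̄) → A(ℚ̄)`
(helpers 4/5) is Galois-compatible and, `A` being geometrically isotypic, reaches every
`ℓ`-torsion point of `A(ℚ̄)` from `ℓ`-power torsion of `E(ℚ̄)` (helpers 5/5); the torsion
filtration (helpers 1/5) cuts `W[ℓ] ≅ E[ℓ] ↪ A[ℓ]` down to an equivariant quotient of a stable
subgroup of `𝔽_ℓ^r ⊗ V`; the isotypic lemma and averaging (helpers 3/5) produce a non-zero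
`Γ`-invariant in `H`, i.e. a non-zero `ℚ`-homomorphism `E → A` — excluded.

Deliberately NOT here: no definitions, no named fact; the composition with Minkowski and the
rational-part reduction (neighbouring stubs of the line).
-/

noncomputable section

-- `Summit.<Summit>.<Problem>` is the mandated summit-side namespace (CONVENTIONS §2); for the
-- single-conjunct summit `ABC` the two coincide, so the duplicate `ABC.ABC` is deliberate.
set_option linter.dupNamespace false

namespace Summit.ABC.ABC.Theorems.IsotypicMinkowski

open scoped AddSubgroup

open CategoryTheory CategoryTheory.Limits AlgebraicGeometry
open Literature.AlgebraicGeometry.Motives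
open Summit.ABC.ABC.Theses.IsogenyGlueCongruence

namespace BigImage

/-! ## From the finite image to `GL_r(ℤ)`; the algebraic core assembled -/

/-- **From a `ℤ`-linear action to a subgroup of `GL_r(ℤ)`** (the shape Minkowski's bound
consumes): for a `ℤ`-linear representation `ρ` of a group `Γ` on a free `ℤ`-module `H` of rank
`r`, the image group `ρ(Γ) ≤ Aut(H)` (`ρ.asGroupHom.range`) is isomorphic to a subgroup of
`GL_r(ℤ)` (matrices in a basis). Proof taken over from the line's wave-3 plan file, (A3). -/
theorem exists_subgroup_generalLinearGroup_mulEquiv {Γ H : Type} [Group Γ] [AddCommGroup H]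
    [Module.Free ℤ H] [Module.Finite ℤ H] (ρ : Representation ℤ Γ H) :
    ∃ G : Subgroup (Matrix.GeneralLinearGroup (Fin (Module.finrank ℤ H)) ℤ),
      Nonempty (ρ.asGroupHom.range ≃* G) := by
  classical
  let b := Module.finBasis ℤ H
  let θ : (H →ₗ[ℤ] H)ˣ →* Matrix.GeneralLinearGroup (Fin (Module.finrank ℤ H)) ℤ :=
    Units.map (LinearMap.toMatrixAlgEquiv b).toMulEquiv.toMonoidHom
  have hθ : Function.Injective θ := by
    intro x y hxy
    apply Units.ext
    have h := congrArg (fun u : Matrix.GeneralLinearGroup (Fin (Module.finrank ℤ H)) ℤ ↦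
      (u : Matrix (Fin (Module.finrank ℤ H)) (Fin (Module.finrank ℤ H)) ℤ)) hxy
    simp only [θ, Units.coe_map] at h
    exact (LinearMap.toMatrixAlgEquiv b).toMulEquiv.injective h
  exact ⟨ρ.asGroupHom.range.map θ, ⟨ρ.asGroupHom.range.equivMapOfInjective θ hθ⟩⟩

/-- **The image group of an action with finitely many values is finite**:
`ρ.asGroupHom.range` embeds into `Set.range ρ` by `Units.val`. From the plan file, (A3'). -/
theorem finite_range_asGroupHom {Γ H : Type} [Group Γ] [AddCommGroup H]
    (ρ : Representation ℤ Γ H) (hfin : (Set.range ρ).Finite) : Finite ρ.asGroupHom.range := by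
  have hsub : (ρ.asGroupHom.range : Set (H →ₗ[ℤ] H)ˣ) ⊆ Units.val ⁻¹' Set.range ρ := by
    rintro u ⟨σ, rfl⟩
    exact ⟨σ, (Representation.asGroupHom_apply ρ σ).symm⟩
  have hfin' : (Units.val ⁻¹' Set.range ρ : Set (H →ₗ[ℤ] H)ˣ).Finite :=
    hfin.preimage Units.val_injective.injOn
  exact (hfin'.subset hsub).to_subtype

/-- **The algebraic core of (N†).** Let `Γ` act additively on `P` and `A`, let `V = P[ℓ]` have
`ℓ²` elements (`ℓ` an odd prime) with every additive automorphism of `V` realised by some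
`σ ∈ Γ`; let `ρ` be a `ℤ`-linear action of `Γ` on a free lattice `H` of finite rank with finitely
many values and no non-zero invariants; let `ev : H → Hom(P, A)` satisfy
`ev (σ f) (σ y) = σ (ev f y)`, let `ι : V ↪ A` be equivariant, and let every `ℓ`-torsion element
of `A` be a sum of values `ev f y` with `ℓᵏ y = 0`. Then the (finite) image of `ρ` embeds in
`GL_r(ℤ)`, `r = rank H`, with order divisible by `ℓ`. Indeed otherwise `Γ' = ker ρ` has index
prime to `ℓ`, its operators span `End(V)` (`span_smul_eq_top`), and steps 0–2
(`exists_stable_onto_torsion`, `exists_vector_not_mem`, `false_of_invariant_line`) produce a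
contradiction. -/
theorem exists_subgroup_dvd_card {Γ P A H : Type} [Group Γ] [AddCommGroup P] [AddCommGroup A]
    [AddCommGroup H] [DistribMulAction Γ P] [DistribMulAction Γ A] [Module.Free ℤ H]
    [Module.Finite ℤ H] {ℓ : ℕ} [Fact ℓ.Prime] (hℓ2 : ℓ ≠ 2)
    (hcard : Nat.card (AddSubgroup.torsionBy P ℓ) = ℓ ^ 2)
    (hsV : ∀ φ : AddSubgroup.torsionBy P ℓ ≃+ AddSubgroup.torsionBy P ℓ, ∃ σ : Γ, ∀ v, σ • v = φ v)
    (ρ : Representation ℤ Γ H) (hfin : (Set.range ρ).Finite)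
    (hfix : ∀ f : H, (∀ σ, ρ σ f = f) → f = 0)
    (ev : H →+ P →+ A) (hev : ∀ (σ : Γ) (f : H) (y : P), ev (ρ σ f) (σ • y) = σ • ev f y)
    (ι : AddSubgroup.torsionBy P ℓ →+ A) (hι : Function.Injective ι)
    (hισ : ∀ (σ : Γ) (v : AddSubgroup.torsionBy P ℓ), ι (σ • v) = σ • ι v)
    (hsurj : ∃ k : ℕ, ∀ Q : A, ℓ • Q = 0 →
      Q ∈ AddSubgroup.closure {Q' | ∃ (f : H) (y : P), (ℓ ^ k) • y = 0 ∧ Q' = ev f y}) :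
    ∃ G : Subgroup (Matrix.GeneralLinearGroup (Fin (Module.finrank ℤ H)) ℤ),
      Finite G ∧ ℓ ∣ Nat.card G := by
  classical
  haveI : Finite ρ.asGroupHom.range := finite_range_asGroupHom ρ hfin
  letI : Fintype ρ.asGroupHom.range := Fintype.ofFinite _
  by_cases hdvd : ℓ ∣ Fintype.card ρ.asGroupHom.range
  · obtain ⟨G, ⟨e⟩⟩ := exists_subgroup_generalLinearGroup_mulEquiv ρ
    refine ⟨G, Finite.of_equiv _ e.toEquiv, ?_⟩
    rwa [← Nat.card_congr e.toEquiv, Nat.card_eq_fintype_card]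
  exfalso
  -- the plane `V = P[ℓ]`
  letI : Module (ZMod ℓ) (AddSubgroup.torsionBy P ℓ) := AddSubgroup.torsionBy.zmodModule
  haveI : Finite (AddSubgroup.torsionBy P ℓ) := Nat.finite_of_card_ne_zero
    (by rw [hcard]; exact pow_ne_zero _ (Fact.out : ℓ.Prime).ne_zero)
  haveI : Module.Finite (ZMod ℓ) (AddSubgroup.torsionBy P ℓ) := Module.Finite.of_finite
  have hrank : Module.finrank (ZMod ℓ) (AddSubgroup.torsionBy P ℓ) = 2 := by
    have h := Module.natCard_eq_pow_finrank (K := ZMod ℓ) (V := AddSubgroup.torsionBy P ℓ)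
    rw [hcard, Nat.card_zmod] at h
    exact (Nat.pow_right_injective (Fact.out : ℓ.Prime).two_le h).symm
  let bV := Module.finBasisOfFinrankEq (ZMod ℓ) (AddSubgroup.torsionBy P ℓ) hrank
  -- `Γ' = ker ρ` has index prime to `ℓ`
  haveI : (MonoidHom.ker ρ).Normal := MonoidHom.normal_ker ρ
  have hpow : ∀ σ : Γ, ∃ n : ℕ, ¬ ℓ ∣ n ∧ σ ^ n ∈ MonoidHom.ker ρ := fun σ ↦ by
    refine ⟨Fintype.card ρ.asGroupHom.range, hdvd, ?_⟩
    rw [MonoidHom.mem_ker, map_pow]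
    have h := pow_card_eq_one (G := ρ.asGroupHom.range) (x := ⟨ρ.asGroupHom σ, σ, rfl⟩)
    have h2 := congrArg (fun u : ρ.asGroupHom.range ↦ ((u : (H →ₗ[ℤ] H)ˣ) : H →ₗ[ℤ] H)) h
    simp only [Subgroup.coe_pow, Subgroup.coe_one, Units.val_pow_eq_pow_val, Units.val_one,
      Representation.asGroupHom_apply] at h2
    exact h2
  have hspan := span_smul_eq_top hℓ2 bV hsV (MonoidHom.ker ρ) hpow
  -- irreducibility of `V` under `Γ` (indeed under `Γ'`)
  have hV : ∀ S : AddSubgroup (AddSubgroup.torsionBy P ℓ), (∀ σ : Γ, ∀ v ∈ S, σ • v ∈ S) → S = ⊥ ∨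
      S = ⊤ := by
    intro S hS
    have h := eq_bot_or_eq_top_of_span_eq_top bV hspan (AddSubgroup.toZModSubmodule ℓ S) (by
      rintro _ ⟨σ, rfl⟩ v hv
      exact (AddSubgroup.mem_toZModSubmodule ℓ).2
        (hS σ v ((AddSubgroup.mem_toZModSubmodule ℓ).1 hv)))
    rcases h with h | h
    · left
      rw [← AddSubgroup.toZModSubmodule_toAddSubgroup ℓ S, h, Submodule.bot_toAddSubgroup]
    · right
      rw [← AddSubgroup.toZModSubmodule_toAddSubgroup ℓ S, h, Submodule.top_toAddSubgroup]
  -- steps 0, 1, 2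
  let b := Module.finBasis ℤ H
  obtain ⟨S, hS, π', hSℓ, hπ's, hπ't⟩ := exists_stable_onto_torsion hV ρ b ev hev ι hι hισ hsurj
  obtain ⟨S₀', x, hx, hσx⟩ := exists_vector_not_mem bV ρ b hspan S hS π' hSℓ hπ's hπ't
  exact false_of_invariant_line ρ b hdvd hfix S₀' x hx hσx

end BigImage

/-! ## The stub -/

/-- **(N†) = `stub_bigImageTorsionCore`: big image kills torsion sharing with a `ℚ`-free
geometrically-isotypic partner, up to Minkowski.** With `L₀ = 2`: if `ρ̄_{W,ℓ}` is surjective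
(`ℓ` an odd prime), `A/ℚ` is geometrically `E`-isotypic with `Hom_ℚ(E, A) = 0`, and
`W[ℓ] ↪ A(ℚ̄)` `Γ_ℚ`-equivariantly, then the (finite) Galois image `G` on the lattice
`Hom(E_ℚ̄, A_ℚ̄)` (rank `r ≤ 4 dim A`) is a finite subgroup of `GL_r(ℤ)` of order divisible by
`ℓ`. Proof: `BigImage.exists_subgroup_dvd_card` (torsion filtration instead of Brauer–Nesbitt,
the isotypic lemma under `span ρ̄(ker(Γ → G)) = End(E[ℓ])`, and averaging) applied to the
Hom-lattice `BigImage.homGaloisLattice'`, the corner evaluation (`BigImage.corner_ev_smul`), the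
transport of `W[ℓ]` to `E[ℓ]` along `e`, and the expansion of `[N]_{A_ℚ̄}` along the isotypic
ideal (`nsmul_id_mem_closure`, `BigImage.mem_closure_corner`). -/
theorem stub_bigImageTorsionCore :
    ∃ L₀ : ℕ, ∀ (W : WeierstrassCurve ℚ) [W.IsElliptic] (E A : AbelianVariety.{0} ℚ)
      (e : E.geomPoints ≃+ W.geomPoints),
      (∀ (σ : Field.absoluteGaloisGroup ℚ) (P : E.geomPoints), e (σ • P) = σ • e P) →
      (∀ (C : AbelianVariety.{0} (AlgebraicClosure ℚ))
          (g : A.baseChange (AlgebraicClosure ℚ) ⟶ C),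
          Surjective (AbelianVariety.Hom.toSchemeHom g) → C.dim ≠ 0 →
          ∃ f : E.baseChange (AlgebraicClosure ℚ) ⟶ C, f ≠ 0) →
      (∀ f : E ⟶ A, f = 0) →
      ∀ ℓ : ℕ, ℓ.Prime → L₀ < ℓ → W.HasSurjectiveModNGaloisRep ℓ →
      (∃ ι : W.geomTorsion ℓ →+ A.geomPoints, Function.Injective ι ∧
        ∀ (σ : Field.absoluteGaloisGroup ℚ) (P : W.geomTorsion ℓ), ι (σ • P) = σ • ι P) →
        ∃ (r : ℕ) (G : Subgroup (Matrix.GeneralLinearGroup (Fin r) ℤ)),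
          r ≤ 4 * A.dim ∧ Finite G ∧ ℓ ∣ Nat.card G := by
  refine ⟨2, ?_⟩
  intro W _ E A e he hiso hfree ℓ hℓ h2ℓ hs hι
  obtain ⟨ι, hιinj, hισ⟩ := hι
  haveI : Fact ℓ.Prime := ⟨hℓ⟩
  have hℓ2 : ℓ ≠ 2 := by omega
  -- the Hom-lattice
  obtain ⟨hfreeZ, hfinZ, hrank, ρ, hρ, hfin, hfix⟩ := BigImage.homGaloisLattice' E A
  haveI := hfreeZ
  haveI := hfinZ
  have hE1 : E.dim = 1 := dim_eq_one_of_equiv e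
  -- the restriction of `e` to the `ℓ`-torsion
  let eℓ : E.geomTorsion ℓ ≃+ W.geomTorsion ℓ :=
    { e.toEquiv.subtypeEquiv fun P ↦ (map_mem_geomTorsion_iff e ℓ P).symm with
      map_add' := fun x y ↦ Subtype.ext (map_add e (x : E.geomPoints) (y : E.geomPoints)) }
  have heℓ : ∀ x : E.geomTorsion ℓ, ((eℓ x : W.geomTorsion ℓ) : W.geomPoints) = e x := fun x ↦ rfl
  have heℓσ : ∀ (σ : Field.absoluteGaloisGroup ℚ) (x : E.geomTorsion ℓ), eℓ (σ • x) = σ • eℓ x :=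
    fun σ x ↦ Subtype.ext (by
      rw [heℓ, Literature.NumberTheory.EllipticCurves.AddSubgroup.torsionBy.coe_smul,
        Literature.NumberTheory.EllipticCurves.AddSubgroup.torsionBy.coe_smul, heℓ, he])
  -- (T1) `#E[ℓ] = ℓ²`
  have hcard : Nat.card (E.geomTorsion ℓ) = ℓ ^ 2 := by
    rw [Nat.card_congr eℓ.toEquiv]
    have h := Literature.NumberTheory.EllipticCurves.natCard_geomTorsion_int_eq_sq W
      (n := (ℓ : ℤ)) (by exact_mod_cast hℓ.ne_zero)
    rwa [Int.natAbs_natCast] at h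
  -- (T2) every additive automorphism of `E[ℓ]` is Galois
  have hsV : ∀ φ : E.geomTorsion ℓ ≃+ E.geomTorsion ℓ, ∃ σ : Field.absoluteGaloisGroup ℚ,
      ∀ v, σ • v = φ v := fun φ ↦ by
    have hs' : Function.Surjective (W.galoisRepTorsion ℓ) := hs
    obtain ⟨σ, hσ⟩ := hs' (Multiplicative.ofAdd (eℓ.symm.trans (φ.trans eℓ)))
    refine ⟨σ, fun v ↦ eℓ.injective ?_⟩
    have h := WeierstrassCurve.galoisRepTorsion_apply W ℓ σ (eℓ v)
    rw [hσ] at h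
    rw [heℓσ, ← h]
    simp
  -- (T3) `E[ℓ] ↪ A(ℚ̄)` equivariantly
  let ι' : E.geomTorsion ℓ →+ A.geomPoints := ι.comp eℓ.toAddMonoidHom
  have hι'inj : Function.Injective ι' := hιinj.comp eℓ.injective
  have hι'σ : ∀ (σ : Field.absoluteGaloisGroup ℚ) (v : E.geomTorsion ℓ), ι' (σ • v) = σ • ι' v :=
    fun σ v ↦ by
      change ι (eℓ (σ • v)) = σ • ι (eℓ v)
      rw [heℓσ, hισ]
  -- (T4) no invariants
  have hfix' : ∀ f : E.baseChange (AlgebraicClosure ℚ) ⟶ A.baseChange (AlgebraicClosure ℚ),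
      (∀ σ, ρ σ f = f) → f = 0 := fun f hf ↦ by
    obtain ⟨f₀, rfl⟩ := (hfix f).1 hf
    rw [hfree f₀]
    have h := AbelianVariety.Hom.baseChange_add (AlgebraicClosure ℚ) (0 : E ⟶ A) 0
    rw [add_zero] at h
    exact left_eq_add.1 h
  -- (T5) the corner evaluation
  let ev : (E.baseChange (AlgebraicClosure ℚ) ⟶ A.baseChange (AlgebraicClosure ℚ)) →+
      E.geomPoints →+ A.geomPoints :=
    AddMonoidHom.mk' (fun f ↦ AddMonoidHom.mk' (fun y ↦
      AbelianVariety.Hom.geomPointsMap (biprod.snd : E ⊞ A ⟶ A)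
        ((((AddMonoidHom.id (E ⊞ A).geomPoints).comp (MonoidHom.toAdditive ((E ⊞ A).pointsEnd
          (AlgebraicClosure ℚ)
          (AbelianVariety.Hom.baseChange (AlgebraicClosure ℚ) (biprod.fst : E ⊞ A ⟶ E) ≫ f ≫
            AbelianVariety.Hom.baseChange (AlgebraicClosure ℚ) (biprod.inr : A ⟶ E ⊞ A))))).comp
          (AddMonoidHom.id (E ⊞ A).geomPoints))
          (AbelianVariety.Hom.geomPointsMap (biprod.inl : E ⟶ E ⊞ A) y)))
      (fun y y' ↦ by rw [map_add, map_add, map_add])) (fun f g ↦ by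
      ext y
      simp only [AddMonoidHom.add_apply, AddMonoidHom.mk'_apply]
      rw [Preadditive.add_comp, Preadditive.comp_add,
        ← map_add (AbelianVariety.Hom.geomPointsMap (biprod.snd : E ⊞ A ⟶ A))]
      congr 1
      exact BigImage.act_add (E ⊞ A) _ _ _)
  have hev : ∀ (σ : Field.absoluteGaloisGroup ℚ) (f) (y : E.geomPoints),
      ev (ρ σ f) (σ • y) = σ • ev f y := fun σ f y ↦ by
    change AbelianVariety.Hom.geomPointsMap (biprod.snd : E ⊞ A ⟶ A) _ =
      σ • AbelianVariety.Hom.geomPointsMap (biprod.snd : E ⊞ A ⟶ A) _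
    rw [hρ σ f]
    exact BigImage.corner_ev_smul E A σ f y
  -- (T6) `ℓ`-torsion of `A(ℚ̄)` through the corner
  haveI : Normal ℚ (AlgebraicClosure ℚ) := normal_algebraicClosure_rat
  have hE1' : (E.baseChange (AlgebraicClosure ℚ)).dim = 1 := by
    rw [AbelianVariety.dim_baseChange, hE1]
  obtain ⟨N, hN, hmem⟩ := nsmul_id_mem_closure (E.baseChange (AlgebraicClosure ℚ))
    (A.baseChange (AlgebraicClosure ℚ)) hE1' hiso
  obtain ⟨k, hk⟩ := BigImage.mem_closure_corner E A hN hmem hℓ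
  have hsurj : ∃ k : ℕ, ∀ Q : A.geomPoints, ℓ • Q = 0 →
      Q ∈ AddSubgroup.closure {Q' | ∃ (f : E.baseChange (AlgebraicClosure ℚ) ⟶
        A.baseChange (AlgebraicClosure ℚ)) (y : E.geomPoints), (ℓ ^ k) • y = 0 ∧ Q' = ev f y} :=
    ⟨k, hk⟩
  -- the algebraic core
  obtain ⟨G, hG, hdvd⟩ := BigImage.exists_subgroup_dvd_card hℓ2 hcard hsV ρ hfin hfix' ev hev
    ι' hι'inj hι'σ hsurj
  refine ⟨_, G, ?_, hG, hdvd⟩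
  calc Module.finrank ℤ (E.baseChange (AlgebraicClosure ℚ) ⟶ A.baseChange (AlgebraicClosure ℚ))
      ≤ 4 * E.dim * A.dim := hrank
    _ = 4 * A.dim := by rw [hE1, mul_one]


end Summit.ABC.ABC.Theorems.IsotypicMinkowski

end
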